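import Summits.QuantumFields.BalabanUV.Beta.GAN24.ChargeTowerClimbZero
import Summits.QuantumFields.BalabanUV.Beta.GAN24.ChargeTowerRegauge
import Summits.QuantumFields.BalabanUV.Beta.GAN24.SrecChargeLamDropsAllLevels
import Summits.QuantumFields.BalabanUV.Beta.GAN24.EdgePlaquettePotential

/-!
# `BalabanUV.Beta.GAN24.ChargeTowerInduction` — binder row G-an2-4 ∕ (CONV-C), the (S) row ∕ (W-γ) AT EVERY LEVEL («the Δ_j-exact charge tower», road-P2 gen 42, memo
# `HOME/b2b-balaban-gan24-p2/gen41/W-GAMMA-TOWER-v0.md` §8): **THE INDUCTION** — at every level `j + 1` the exit⊗exit charge function of the pure S table is `Δ_{j+1}`-EXACT,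
# with a BOUNDED, COMB-GAUGED, `Lc`-PERIODIC potential and NO constant; hence it reads ZERO through every `ℋ`-column of the co-dressed step resolvent `G_{j+1}`

NOT IN PRINT; OUR BOOKKEEPING ([folklore] by name: the typed ladder `ChargeTowerClimbZero` §4 (rung `0 → 1`), `ChargeTowerClimb` §7 (rung `j+1 → j+2`) and §8 ((M1) at every level),
`ChargeTowerRegauge` §2–§4 (re-gauging inside the value-Hessian image; the periodicity ledger), leaf-02 g57's PART B `SrecChargeBlockPotentials.tsum_prod_exitWt_srecAt_zero` ((I3)_0 in this
road's currency) and PART D `SrecChargeLamDropsAllLevels.tsum_prod_exitWt_srecAt_eq_spureRecAt` (full ↔ pure member), leaf-02 g55's `FaceChargeCurlResummation.curv_faceForm`, leaf-06 g46's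
`EdgePlaquettePotential` (`wedge_blk_eq`, `curvAdj_curv_edgePotential`, `abs_edgePotential_le_one`, `edgePotential_add_zsmul`, `curvAdj_mul_sub_apply`, `curvAdj_curv_sub_dz`) and
`EdgePotentialColumnOrthogonal.abs_axProjAt_le`, an2's `RootedComb.axProjAt_apply` ∕ `AxialCoordinateProjector.axProjAt_eq_zero_of_isCombBond`; 0 `def`, 0 cited fact, 0 `def … : Prop`,
0 sorry).  HONEST FRAMING (cell contract, verbatim): «discharging `BetaPertH` makes Bałaban's UV stability UNCONDITIONAL — a real constructive-QFT result; it is NOT the continuum limit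
and NOT the Clay problem.»  HONEST DEPENDENCY (verbatim): «continuum YM on T⁴ ⇐ BetaPertH ∧ nine spine estimates (0/9 proved); BetaPertH ⇐ (D1) ∧ (D4) ∧ CAP+tail; G-an2-4 gates asym,
D1 and NE2/3/4.»

Notation: in-block root `r ∈ box (d+1) Lc`, `ρ = toSite r`; `S_{j} := SpureRecAt d Lc ρ cE cVH cΛ j` (pure), `SrecAt … j` (full); `G_j := coDressKBmAt ρ Lc (KInvStep Lc j)`;
`(Δ_{j+1} m)(κ,u) := wVH_{j+1}·Σ'_v Σ_l wΦ_{Lc^{j+1}} κ l (u − v)·m l v`; the `N`-EXIT INDICATOR `𝟙^{exit,N}_a(x) := [x_a % N = N − 1]`; `Π^ρ = axProjAt ρ Lc` (hard-axial representative),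
`𝒬_{Lc} = contourSum Lc`; `m̃^L_{ab}` = leaf-06's edge potential at scale `L` (written out in closed form, as there).
* §1 (W) `emod_mul_iff` ∕ **`exitWt_blk_eq`**: `𝟙[s % Lc = Lc−1]·𝟙[(s∕Lc) % M = M−1] = 𝟙[s % (Lc·M) = Lc·M − 1]` — this road's pulled-back weight `𝟙^{exit,Lc}·(f∘blk)` with
  `f = 𝟙^{exit,M}` IS the `Lc·M`-exit indicator: the tower's class `{exit^{Lc^m}}` is closed under (I1)'s pull-back, one factor of `Lc` per level.
* §2 `const_mul_E2image` (a scalar slips into the potential), `curvAdj_const_mul`, **`curvAdj_curv_faceForm_eq_edgePotential`** (THE BASE JUNCTION, `a ≠ b`, `1 ≤ L`):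
  `d*d((−c∕4)·m[ψ_a,ψ_b]) = d*d((−c∕2)·m̃^L_{ab})` — PART 7's face form (`curv = 2·dψ_a ∧ dψ_b = 2·E_ab·𝟙^{exit,L}_a𝟙^{exit,L}_b`, `curv_faceForm` ⨾ `wedge_blk_eq`) and leaf-06's bounded
  `L`-periodic edge potential (`curv = E_ab·(𝟙^{exit,L}_a𝟙^{exit,L}_b − L⁻²)`) have the same `(d*d)`-image: the constant 2-form is invisible to `curvAdj`.  The memo's «(d*d)m̃ = ½(d*d)m».
* §3 **`exitCharge_srecAt_zero_eq_curvAdj_curv`** (THE BASE `hC`, every extra period `M ≥ 1`): the level-0 charge function of the FULL member against the pulled-back weights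
  `𝟙^{exit,Lc}_α·𝟙^{exit,M}(blk_α) ⊗ 𝟙^{exit,Lc}_β·𝟙^{exit,M}(blk_β)` is `d*d m₀` with `m₀ := Π^ρ((−cE∕2)·m̃^{Lc·(Lc·M)}_{αβ})` — BOUNDED, ZERO ON THE COMB BONDS, `Lc·(Lc·M)`-PERIODIC
  (PART B with the staircase primitives `⌊·∕(Lc·M)⌋` ⨾ §2 ⨾ `curvAdj_curv_sub_dz`).
* §4 **`tower_zero`** (THE FIRST RUNG, every `M ≥ 1`): `∃ m₁` bounded, comb-zero, `(Lc·M)`-periodic with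
  `∀ ν y′, Σ'_{(x,z)} 𝟙^{exit,Lc·M}_α(x)·𝟙^{exit,Lc·M}_β(z)·S_1 ν y′ x z (inl α)(inl β) = (Δ_1 m₁)(ν,y′)` (`ChargeTowerClimbZero` §4 at `a = 1`, `c = 0` ⨾ `ChargeTowerRegauge` §2 ⨾ the ledger).
* §5 **`tower_succ`** (THE RUNG `j+1 → j+2`): the same data at level `j+1` for the period `Lc·(Lc·M)` give the data at level `j+2` for the period `Lc·M` (PART D ⨾ (W) ⨾ `ChargeTowerClimb` §7 at
  `c = 0` ⨾ `ChargeTowerRegauge` §2–§4); **`tower`** (induction on `j`, `M ↦ Lc·M` in the hypothesis): every level `j+1`, every `M ≥ 1`.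
* THE TARGET OF THE MEMO (§8) at `M = 1` — the pure exit class `𝟙^{exit,Lc}_α ⊗ 𝟙^{exit,Lc}_β` with an `Lc`-periodic potential, the same for the FULL member, and the orthogonality to every
  `ℋ`-column of `G_{j+1}` by (M1)_{j+1} — is read off `tower` in the companion file `ChargeTowerExitOrthogonal` (kept apart for the 400-line rule).
READING.  This closes the exact-part induction of the tower for the class `{exit^{Lc^m}}` (E28 (B): jb = 0, 1, exact to 2e-15–2e-14, totals ≤ 6e-11 — here `= 0` identically): the
input leaf-06's (γ)∕(α⁺) mechanism consumes at level `j+1` is a theorem for every `j`.  What this file does NOT supply: the read vectors `r(e) = v_γ + v_{α⁺}` of (W-γ) and their pairing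
(leaf-06's FILES A–F one level up), the entry∕slab classes (engine FALSE, memo §3), anything of (INV) ∕ (S) ∕ (Q-R) ∕ (LT) ∕ (Q-L) ∕ (C) ∕ «T2Shape» ∕ «T2Drift» ∕ (hW, hWall).  Asserts NO
value of Bałaban's tables; NEVER «G-an2-4 closed» as (CONV-C); NOT D1, NOT `BetaPertH`, NOT continuum, NOT Clay.  2026-08-22; no existing file touched.
-/

noncomputable section

open Finset
open scoped BigOperators
open Literature.MathematicalPhysics.QuantumFieldTheory
open Literature.MathematicalPhysics.QuantumFieldTheory.Balaban1983to89
open Literature.MathematicalPhysics.QuantumFieldTheory.Balaban1983to89.Beta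
open ExpKernelCalculus (Site MKer)
open AffineAveraging (Form0 Form1 Form2 box toSite unitVec dz curv curvAdj contourSum)
open AveragingContours (blk)
open AveragingContoursRooted (treeGaugeAt)
open RootedComb (axProjAt axProjAt_apply)
open KernelSpecInstance (wΦ)
open OneStepResolventKernel (Fib)
open OneStepKernelFamily (KInvStep colH)
open BalabanStepJetsSucc (wVH wE)
open Summit.QuantumFields.BalabanUV.Beta.AxialDressingRooted (IsCombBondAt coDressKBmAt one_le_of_neZero axProjAt_eq_zero_of_isCombBond)
open Summit.QuantumFields.BalabanUV.Beta.BorderedHessian (stepScale)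
open Summit.QuantumFields.BalabanUV.Beta.SpineRooted (SpureRecAt)
open Summit.QuantumFields.BalabanUV.Beta.WardLocusRecursive (SrecAt)
open Summit.QuantumFields.BalabanUV.Beta.GAN24.SymLinKernelFaceSupport (int_ediv_add_one)
open Summit.QuantumFields.BalabanUV.Beta.GAN24.FaceChargeCurlResummation (curv_faceForm)
open Summit.QuantumFields.BalabanUV.Beta.GAN24.EdgePlaquettePotential (abs_edgePotential_le_one edgePotential_add_zsmul wedge_blk_eq curvAdj_curv_edgePotential
  curvAdj_mul_sub_apply curvAdj_curv_sub_dz)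
open Summit.QuantumFields.BalabanUV.Beta.GAN24.EdgePotentialColumnOrthogonal (abs_axProjAt_le)
open Summit.QuantumFields.BalabanUV.Beta.GAN24.SrecChargeBlockPotentials (tsum_prod_exitWt_srecAt_zero curvAdj_curv_const_mul)
open Summit.QuantumFields.BalabanUV.Beta.GAN24.SrecChargeLamDropsAllLevels (tsum_prod_exitWt_srecAt_eq_spureRecAt)
open Summit.QuantumFields.BalabanUV.Beta.GAN24.ChargeTowerClimb (hasSum_prod_coordWeighted_SpureRecAt_of_exact_add_const)
open Summit.QuantumFields.BalabanUV.Beta.GAN24.ChargeTowerClimbZero (hasSum_prod_coordWeighted_SpureRecAt_one_of_exact_add_const)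
open Summit.QuantumFields.BalabanUV.Beta.GAN24.ChargeTowerRegauge (tsum_sum_wΦ_mul_axProjAt_eq abs_smul_contourSum_le axProjAt_climbed_bdd_and_comb_zero
  contourSum_add_zsmul_of_periodic_mul axProjAt_add_zsmul_of_periodic_mul)

namespace Summit.QuantumFields.BalabanUV.Beta.GAN24.ChargeTowerInduction

variable {d : ℕ} {Lc : ℕ} [NeZero Lc] {r : Fin (d + 1) → ℕ}

/-! ## §1 (W): the pulled-back exit weight is the exit weight of the product period -/

omit [NeZero Lc] in
/-- [folklore] **`s % (Lc·M) = Lc·M − 1 ⟺ s % Lc = Lc − 1 ∧ (s∕Lc) % M = M − 1`** (`1 ≤ Lc`, `1 ≤ M`; Euclidean division twice). -/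
theorem emod_mul_iff {M : ℕ} (hLc : 1 ≤ Lc) (hM : 1 ≤ M) (s : ℤ) :
    (s % (Lc : ℤ) = (Lc : ℤ) - 1 ∧ s / (Lc : ℤ) % (M : ℤ) = (M : ℤ) - 1)
      ↔ s % ((Lc * M : ℕ) : ℤ) = ((Lc * M : ℕ) : ℤ) - 1 := by
  have hL0 : (0 : ℤ) < Lc := by exact_mod_cast hLc
  have hM0 : (0 : ℤ) < M := by exact_mod_cast hM
  push_cast
  set N : ℤ := (Lc : ℤ) * (M : ℤ) with hN
  have hN0 : 0 < N := mul_pos hL0 hM0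
  set t : ℤ := s % N with ht
  set q : ℤ := s / N with hq
  have hs : s = t + (Lc : ℤ) * ((M : ℤ) * q) := by
    have h := Int.emod_add_mul_ediv s N
    rw [← ht, ← hq] at h
    linear_combination -h
  have ht0 : 0 ≤ t := Int.emod_nonneg s (ne_of_gt hN0)
  have ht1 : t < N := Int.emod_lt_of_pos s hN0
  -- reduce `s % Lc` and `s / Lc % M` to the residue `t`
  have e1 : s % (Lc : ℤ) = t % (Lc : ℤ) := by
    rw [hs, Int.add_mul_emod_self_left]
  have e2 : s / (Lc : ℤ) % (M : ℤ) = t / (Lc : ℤ) := by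
    rw [hs, Int.add_mul_ediv_left _ _ (ne_of_gt hL0), Int.add_mul_emod_self_left]
    refine Int.emod_eq_of_lt (Int.ediv_nonneg ht0 hL0.le) (Int.ediv_lt_of_lt_mul hL0 ?_)
    rw [mul_comm]; exact ht1
  rw [e1, e2]
  constructor
  · rintro ⟨h1, h2⟩
    have h := Int.emod_add_mul_ediv t (Lc : ℤ)
    rw [h1, h2] at h
    linear_combination -h
  · intro h
    have et : t = (Lc : ℤ) - 1 + (Lc : ℤ) * ((M : ℤ) - 1) := by rw [h]; ring
    constructor
    · rw [et, Int.add_mul_emod_self_left]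
      exact Int.emod_eq_of_lt (by linarith) (by linarith)
    · rw [et, Int.add_mul_ediv_left _ _ (ne_of_gt hL0), Int.ediv_eq_zero_of_lt (by linarith) (by linarith), zero_add]

omit [NeZero Lc] in
/-- NOT IN PRINT; OUR BOOKKEEPING.  **(W) THE PULLED-BACK EXIT WEIGHT IS THE EXIT WEIGHT OF THE PRODUCT PERIOD** (`1 ≤ Lc`, `1 ≤ M`, every site `x`, direction `a`):
`𝟙[x_a % Lc = Lc−1]·𝟙[(blk Lc x)_a % M = M−1] = 𝟙[x_a % (Lc·M) = Lc·M−1]` — this road's weight `𝟙^{exit,Lc}_a·(f∘blk_a)` (`ChargeTowerStep` ∕ `ChargeTowerClimb` §7's `hC`) with `f = 𝟙^{exit,M}`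
IS `𝟙^{exit,Lc·M}_a`: (I1)'s pull-back sends `exit^{Lc·M}` one level up to `exit^{Lc·(Lc·M)}` one level down. -/
theorem exitWt_blk_eq {M : ℕ} (hLc : 1 ≤ Lc) (hM : 1 ≤ M) (x : Site (d + 1)) (a : Fin (d + 1)) :
    (if x a % (Lc : ℤ) = (Lc : ℤ) - 1 then (if blk Lc x a % (M : ℤ) = (M : ℤ) - 1 then (1 : ℝ) else 0) else 0)
      = if x a % ((Lc * M : ℕ) : ℤ) = ((Lc * M : ℕ) : ℤ) - 1 then (1 : ℝ) else 0 := by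
  have eb : blk Lc x a = x a / (Lc : ℤ) := rfl
  rw [eb]
  by_cases h : x a % ((Lc * M : ℕ) : ℤ) = ((Lc * M : ℕ) : ℤ) - 1
  · obtain ⟨h1, h2⟩ := (emod_mul_iff hLc hM (x a)).2 h
    rw [if_pos h, if_pos h1, if_pos h2]
  · rw [if_neg h]
    by_cases h1 : x a % (Lc : ℤ) = (Lc : ℤ) - 1
    · rw [if_pos h1, if_neg (fun h2 => h ((emod_mul_iff hLc hM (x a)).1 ⟨h1, h2⟩))]
    · rw [if_neg h1]

omit [NeZero Lc] in
/-- [folklore] The `N`-exit indicator is bounded by `1`. -/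
theorem abs_exitInd_le_one (N : ℤ) (s : ℤ) : |(if s % N = N - 1 then (1 : ℝ) else 0)| ≤ 1 := by
  split_ifs
  · rw [abs_one]
  · rw [abs_zero]; exact zero_le_one

omit [NeZero Lc] in
/-- [folklore] The staircase `F = ⌊·∕N⌋` is a primitive of the `N`-exit indicator: `F(t+1) − F(t) = 𝟙[t % N = N−1]` (`1 ≤ N`; leaf-02's `int_ediv_add_one`). -/
theorem staircase_forwardDiff {N : ℕ} (hN : 1 ≤ N) (t : ℤ) :
    (((((t + 1) / (N : ℤ) : ℤ)) : ℝ)) - (((t / (N : ℤ) : ℤ)) : ℝ) = if t % (N : ℤ) = (N : ℤ) - 1 then (1 : ℝ) else 0 := by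
  rw [int_ediv_add_one hN]
  push_cast
  split_ifs <;> simp

/-! ## §2 Scalars slip into the potential; the base junction `d*d((−c∕4)·face form) = d*d((−c∕2)·edge potential)` -/

omit [NeZero Lc] in
/-- [folklore] **A SCALAR SLIPS INTO THE POTENTIAL**: `A·(w·Σ'_y Σ_κ wΦ_M ν κ (y′ − y)·n κ y) = w·Σ'_y Σ_κ wΦ_M ν κ (y′ − y)·(A·n κ y)` (no summability needed). -/
theorem const_mul_E2image (A w : ℝ) (M : ℕ) [NeZero M] (n : Form1 (d + 1) ℝ) (ν : Fin (d + 1)) (y' : Site (d + 1)) :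
    A * (w * ∑' y, ∑ κ : Fin (d + 1), wΦ (N := M) ν κ (y' - y) * n κ y)
      = w * ∑' y, ∑ κ : Fin (d + 1), wΦ (N := M) ν κ (y' - y) * (A * n κ y) := by
  rw [mul_left_comm, ← tsum_mul_left]
  congr 1
  refine tsum_congr fun y => ?_
  rw [Finset.mul_sum]
  exact Finset.sum_congr rfl fun κ _ => by ring

omit [NeZero Lc] in
/-- [folklore] `curvAdj` is homogeneous: `curvAdj (c•G) = c•curvAdj G` (pointwise). -/
theorem curvAdj_const_mul (c : ℝ) (G : Form2 (d + 1) ℝ) (μ : Fin (d + 1)) (y : Site (d + 1)) :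
    curvAdj (fun κ l x => c * G κ l x) μ y = c * curvAdj G μ y := by
  simp only [AffineAveraging.curvAdj, Finset.mul_sum, mul_add, mul_sub]

omit [NeZero Lc] in
/-- NOT IN PRINT; OUR BOOKKEEPING.  **THE BASE JUNCTION** (`a ≠ b`, `1 ≤ L`, any scalar `c`): the `(d*d)`-image of `(−c∕4)`× leaf-02 PART 7's FACE FORM
`m[ψ_a,ψ_b] β z = dzψ_b β z·(ψ_a z + ψ_a(z + e_β))` (`ψ_c = ⌊·_c∕L⌋`, unbounded) EQUALS the `(d*d)`-image of `(−c∕2)`× leaf-06's bounded `L`-periodic EDGE POTENTIAL `m̃^L_{ab}`: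
`curv m[ψ_a,ψ_b] = 2·E_ab·𝟙^{exit,L}_a𝟙^{exit,L}_b` (`curv_faceForm` ⨾ `wedge_blk_eq`), `curv m̃^L_{ab} = E_ab·(𝟙^{exit,L}_a𝟙^{exit,L}_b − L⁻²)` (`curv_edgePotential`), and the constant 2-form is
invisible to `curvAdj` (`curvAdj_curv_edgePotential`).  The memo's «(d*d)m̃ = ½(d*d)m», by name. -/
theorem curvAdj_curv_faceForm_eq_edgePotential {L : ℕ} (hL : 1 ≤ L) {a b : Fin (d + 1)} (hab : a ≠ b) (c : ℝ) (μ : Fin (d + 1)) (y : Site (d + 1)) :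
    curvAdj (curv (fun β z => (-(c / 4)) * (dz (fun w : Fin (d + 1) → ℤ => (((w b / (L : ℤ) : ℤ)) : ℝ)) β z
        * ((((z a / (L : ℤ) : ℤ)) : ℝ) + (((z + B6BondElimination.unitVec β) a / (L : ℤ) : ℤ) : ℝ))))) μ y
      = curvAdj (curv (fun β z => (-(c / 2)) * (((L : ℝ) ^ 2)⁻¹ * ((((z + unitVec β) b % (L : ℤ) : ℤ)) : ℝ) * dz (fun w : Fin (d + 1) → ℤ => ((w a : ℤ) : ℝ)) β z
        - (L : ℝ)⁻¹ * (((z a % (L : ℤ) : ℤ)) : ℝ) * dz (fun w : Fin (d + 1) → ℤ => (((w b / (L : ℤ) : ℤ)) : ℝ)) β z))) μ y := by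
  rw [curvAdj_curv_const_mul, curvAdj_curv_const_mul, curvAdj_curv_edgePotential hL hab μ y]
  -- the face form's curl is twice the edge-plaquette 2-form
  have e : curv (fun β z => dz (fun w : Fin (d + 1) → ℤ => (((w b / (L : ℤ) : ℤ)) : ℝ)) β z
        * ((((z a / (L : ℤ) : ℤ)) : ℝ) + (((z + B6BondElimination.unitVec β) a / (L : ℤ) : ℤ) : ℝ)))
      = fun κ l x => 2 * (((if κ = a ∧ l = b then (1 : ℝ) else 0) - (if κ = b ∧ l = a then (1 : ℝ) else 0))
          * ((if x a % (L : ℤ) = (L : ℤ) - 1 then (1 : ℝ) else 0) * (if x b % (L : ℤ) = (L : ℤ) - 1 then (1 : ℝ) else 0))) := by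
    funext κ l x
    rw [curv_faceForm hab κ l x, wedge_blk_eq hL hab κ l x]
  rw [e, curvAdj_const_mul]
  ring

/-! ## §3 The base `hC`: the level-0 exit charge of the full member is `d*d` of a bounded, comb-gauged, periodic potential -/

/-- NOT IN PRINT; OUR BOOKKEEPING.  **THE BASE OF THE TOWER** (in-block root, `α ≠ β`, all `cE cVH cΛ`, every extra period `M ≥ 1`): with `L := Lc·(Lc·M)` and
`m₀ := Π^ρ((−cE∕2)·m̃^L_{αβ})` — BOUNDED (`|m₀| ≤ |cE∕2|·(1 + 2(d+1)Lc)`), ZERO ON THE COMB BONDS, `L`-PERIODIC — the level-0 charge function of the FULL member `SrecAt … 0` against the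
pulled-back weights `𝟙^{exit,Lc}_α(x)·𝟙^{exit,Lc·M}((blk Lc x)_α) ⊗ 𝟙^{exit,Lc}_β(z)·𝟙^{exit,Lc·M}((blk Lc z)_β)` is EXACTLY `(d*d m₀)_κ(u)` at every slot: PART B
`tsum_prod_exitWt_srecAt_zero` with the staircase primitives `⌊·∕(Lc·M)⌋` (`⌊⌊t∕Lc⌋∕(Lc·M)⌋ = ⌊t∕L⌋`), §2, and `d*d(Π^ρ n) = d*d n` (`curvAdj_curv_sub_dz`).  This is the hypothesis `hC` of
`ChargeTowerClimbZero` §4 with `a = 1`, `c = 0`.  PRIOR ART BY NAME: at the COMB scale `L = Lc` an EXPLICIT comb-free, `Lc`-periodic representative `m̂_ab = m̃_ab − dz μ` of the edge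
potential is leaf-06 g47's `EdgePotentialAxialGauge.combFreeEdgePotential_apply ∕ _comb_zero ∕ _add_zsmul` (FILE E, p339344); here the scale is `Lc·(Lc·M) ≥ Lc²` and the representative
is the hard-axial one `Π^ρ`, whose only properties used are boundedness, comb-vanishing and periodicity. -/
theorem exitCharge_srecAt_zero_eq_curvAdj_curv (hr : r ∈ box (d + 1) Lc) (cE cVH cΛ : ℝ) {α β : Fin (d + 1)} (hαβ : α ≠ β) {M : ℕ} (hM : 1 ≤ M) :
    ∃ m : Form1 (d + 1) ℝ, (∃ B : ℝ, ∀ κ u, |m κ u| ≤ B) ∧ (∀ κ u, IsCombBondAt (toSite r) Lc κ u → m κ u = 0) ∧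
      (∀ κ x v, m κ (x + ((Lc * (Lc * M) : ℕ) : ℤ) • v) = m κ x) ∧
      ∀ (κ : Fin (d + 1)) (u : Site (d + 1)), ∑' xz : Site (d + 1) × Site (d + 1),
        (if xz.1 α % (Lc : ℤ) = (Lc : ℤ) - 1 then (if blk Lc xz.1 α % ((Lc * M : ℕ) : ℤ) = ((Lc * M : ℕ) : ℤ) - 1 then (1 : ℝ) else 0) else 0)
          * (if xz.2 β % (Lc : ℤ) = (Lc : ℤ) - 1 then (if blk Lc xz.2 β % ((Lc * M : ℕ) : ℤ) = ((Lc * M : ℕ) : ℤ) - 1 then (1 : ℝ) else 0) else 0)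
          * SrecAt d Lc (toSite r) cE cVH cΛ 0 κ u xz.1 xz.2 (Sum.inl α) (Sum.inl β)
        = 1 * curvAdj (curv m) κ u + (fun _ : Fin (d + 1) => (0 : ℝ)) κ := by
  classical
  have hLc : 1 ≤ Lc := one_le_of_neZero Lc
  have hLc0 : (0 : ℤ) ≤ Lc := by exact_mod_cast (Nat.zero_le Lc)
  have hLM : 1 ≤ Lc * M := Nat.one_le_iff_ne_zero.2 (Nat.mul_ne_zero (by omega) (by omega))
  have hL : 1 ≤ Lc * (Lc * M) := Nat.one_le_iff_ne_zero.2 (Nat.mul_ne_zero (by omega) (by omega))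
  -- leaf-06's edge potential at scale `L = Lc·(Lc·M)`, scaled by `−cE∕2`
  set n : Form1 (d + 1) ℝ := fun l z => (-(cE / 2)) * ((((Lc * (Lc * M) : ℕ) : ℝ) ^ 2)⁻¹ * ((((z + unitVec l) β % ((Lc * (Lc * M) : ℕ) : ℤ) : ℤ)) : ℝ)
      * dz (fun w : Fin (d + 1) → ℤ => ((w α : ℤ) : ℝ)) l z
    - (((Lc * (Lc * M) : ℕ) : ℝ))⁻¹ * (((z α % ((Lc * (Lc * M) : ℕ) : ℤ) : ℤ)) : ℝ)
      * dz (fun w : Fin (d + 1) → ℤ => (((w β / ((Lc * (Lc * M) : ℕ) : ℤ) : ℤ)) : ℝ)) l z) with hn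
  have hnB : ∀ l z, |n l z| ≤ |cE / 2| * 1 := fun l z => by
    simp only [hn]
    rw [abs_mul, abs_neg]
    exact mul_le_mul_of_nonneg_left (abs_edgePotential_le_one hL hαβ l z) (abs_nonneg _)
  have hnper : ∀ l x v, n l (x + ((Lc * (Lc * M) : ℕ) : ℤ) • v) = n l x := fun l x v => by
    simp only [hn]
    rw [edgePotential_add_zsmul hL hαβ l x v]
  refine ⟨axProjAt (toSite r) Lc n, ⟨|cE / 2| * 1 + 2 * ((((d + 1 : ℕ) : ℝ)) * Lc * (|cE / 2| * 1)), fun κ u => abs_axProjAt_le hLc hr hnB κ u⟩,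
    fun κ u h => axProjAt_eq_zero_of_isCombBond h _, fun κ x v => axProjAt_add_zsmul_of_periodic_mul (Lc * M) (toSite r) hnper κ x v, fun κ u => ?_⟩
  -- PART B with the staircase primitives
  have hF : ∀ t : ℤ, (((((t + 1) / ((Lc * M : ℕ) : ℤ) : ℤ)) : ℝ)) - (((t / ((Lc * M : ℕ) : ℤ) : ℤ)) : ℝ)
      = if t % ((Lc * M : ℕ) : ℤ) = ((Lc * M : ℕ) : ℤ) - 1 then (1 : ℝ) else 0 := staircase_forwardDiff hLM
  have hB := tsum_prod_exitWt_srecAt_zero hLc hr cE cVH cΛ (F₁ := fun t : ℤ => (((t / ((Lc * M : ℕ) : ℤ) : ℤ)) : ℝ))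
    (F₂ := fun t : ℤ => (((t / ((Lc * M : ℕ) : ℤ) : ℤ)) : ℝ)) hF hF (fun s => abs_exitInd_le_one _ s) (fun s => abs_exitInd_le_one _ s) κ u α β
  rw [hB, one_mul, add_zero]
  -- the potential of PART B is `(−cE∕4)`× the face form at scale `L`
  have epot : (fun β' z => (-(cE / 4)) * (dz (fun w : Fin (d + 1) → ℤ => (((w β / (Lc : ℤ) / ((Lc * M : ℕ) : ℤ) : ℤ)) : ℝ)) β' z
        * ((((z α / (Lc : ℤ) / ((Lc * M : ℕ) : ℤ) : ℤ)) : ℝ) + (((z + B6BondElimination.unitVec β') α / (Lc : ℤ) / ((Lc * M : ℕ) : ℤ) : ℤ) : ℝ))))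
      = fun β' z => (-(cE / 4)) * (dz (fun w : Fin (d + 1) → ℤ => (((w β / ((Lc * (Lc * M) : ℕ) : ℤ) : ℤ)) : ℝ)) β' z
        * ((((z α / ((Lc * (Lc * M) : ℕ) : ℤ) : ℤ)) : ℝ) + (((z + B6BondElimination.unitVec β') α / ((Lc * (Lc * M) : ℕ) : ℤ) : ℤ) : ℝ))) := by
    funext β' z
    simp only [Int.ediv_ediv_of_nonneg hLc0, Nat.cast_mul]
  rw [epot, curvAdj_curv_faceForm_eq_edgePotential hL hαβ cE κ u]
  -- `d*d` does not see the hard-axial gauge representative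
  have e0 : axProjAt (toSite r) Lc n = fun l z => n l z - dz (treeGaugeAt (toSite r) n Lc) l z := by
    funext l z
    rw [axProjAt_apply]
    rfl
  rw [e0, curvAdj_curv_sub_dz]

/-! ## §4 The first rung: level `1`, every extra period -/

/-- NOT IN PRINT; OUR BOOKKEEPING.  **THE FIRST RUNG OF THE TOWER** (in-block root, `α ≠ β`, all `cE cVH cΛ`, every `M ≥ 1`): there is a 1-form `m₁` — BOUNDED, ZERO ON THE COMB BONDS,
`(Lc·M)`-PERIODIC — with `∀ ν y′, Σ'_{(x,z)} 𝟙^{exit,Lc·M}_α(x)·𝟙^{exit,Lc·M}_β(z)·SpureRecAt … 1 ν y′ x z (inl α)(inl β) = (Δ_1 m₁)(ν,y′)` — `ChargeTowerClimbZero` §4 (`a = 1`, `c = 0`) on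
§3's `hC`, the climbed potential re-gauged INSIDE the `wΦ`-image (`ChargeTowerRegauge.tsum_sum_wΦ_mul_axProjAt_eq`) and the outer scalar `(cE·wE_1)·cH_0²` slipped into it;
explicitly `m₁ = (cE·wE_1)·cH_0²·Π^ρ(wVH_1⁻¹·𝒬_{Lc} m₀)`, periodic by the ledger (`contourSum_add_zsmul_of_periodic_mul` ⨾ `axProjAt_add_zsmul_of_periodic_mul`). -/
theorem tower_zero (hr : r ∈ box (d + 1) Lc) (cE cVH cΛ : ℝ) {α β : Fin (d + 1)} (hαβ : α ≠ β) {M : ℕ} (hM : 1 ≤ M) :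
    ∃ m : Form1 (d + 1) ℝ, (∃ B : ℝ, ∀ κ u, |m κ u| ≤ B) ∧ (∀ κ u, IsCombBondAt (toSite r) Lc κ u → m κ u = 0) ∧
      (∀ κ x v, m κ (x + ((Lc * M : ℕ) : ℤ) • v) = m κ x) ∧
      ∀ (ν : Fin (d + 1)) (y' : Site (d + 1)), ∑' xz : Site (d + 1) × Site (d + 1),
        (if xz.1 α % ((Lc * M : ℕ) : ℤ) = ((Lc * M : ℕ) : ℤ) - 1 then (1 : ℝ) else 0) * (if xz.2 β % ((Lc * M : ℕ) : ℤ) = ((Lc * M : ℕ) : ℤ) - 1 then (1 : ℝ) else 0)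
          * SpureRecAt d Lc (toSite r) cE cVH cΛ (0 + 1) ν y' xz.1 xz.2 (Sum.inl α) (Sum.inl β)
        = wVH d Lc (0 + 1) * ∑' v, ∑ l : Fin (d + 1), wΦ (N := Lc ^ (0 + 1)) ν l (y' - v) * m l v := by
  classical
  have hLc : 1 ≤ Lc := one_le_of_neZero Lc
  obtain ⟨m₀, ⟨B₀, hB₀⟩, hm₀0, hper₀, hC⟩ := exitCharge_srecAt_zero_eq_curvAdj_curv hr cE cVH cΛ hαβ hM
  -- the climbed potential and its hard-axial representative
  set m' : Form1 (d + 1) ℝ := fun l v => (1 / wVH d Lc (0 + 1)) * contourSum Lc m₀ l v with hm'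
  have hm'B : ∀ l v, |m' l v| ≤ |1 / wVH d Lc (0 + 1)| * ((box (d + 1) Lc).card * (Lc * B₀)) := fun l v => abs_smul_contourSum_le Lc hB₀ _ l v
  have hm'per : ∀ l x v, m' l (x + ((Lc * M : ℕ) : ℤ) • v) = m' l x := fun l x v => by
    simp only [hm']
    rw [contourSum_add_zsmul_of_periodic_mul (Lc * M) hper₀ l x v]
  set A : ℝ := (cE * wE d Lc 1) * ((stepScale d Lc 0 * (Lc : ℝ) ^ (d + 1))⁻¹ ^ 2) with hA
  refine ⟨fun l v => A * axProjAt (toSite r) Lc m' l v,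
    ⟨|A| * (|1 / wVH d Lc (0 + 1)| * ((box (d + 1) Lc).card * (Lc * B₀)) + 2 * ((((d + 1 : ℕ) : ℝ)) * Lc * (|1 / wVH d Lc (0 + 1)| * ((box (d + 1) Lc).card * (Lc * B₀))))),
      fun κ u => by rw [abs_mul]; exact mul_le_mul_of_nonneg_left (abs_axProjAt_le hLc hr hm'B κ u) (abs_nonneg _)⟩,
    fun κ u h => by simp only [axProjAt_eq_zero_of_isCombBond h _, mul_zero],
    fun κ x v => by simp only [axProjAt_add_zsmul_of_periodic_mul M (toSite r) hm'per κ x v], fun ν y' => ?_⟩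
  -- `ChargeTowerClimbZero` §4 with `a = 1`, `c = 0`
  have h4 := hasSum_prod_coordWeighted_SpureRecAt_one_of_exact_add_const hr cE cVH cΛ α β
    (fun s : ℤ => if s % ((Lc * M : ℕ) : ℤ) = ((Lc * M : ℕ) : ℤ) - 1 then (1 : ℝ) else 0)
    (fun s : ℤ => if s % ((Lc * M : ℕ) : ℤ) = ((Lc * M : ℕ) : ℤ) - 1 then (1 : ℝ) else 0)
    (fun s => abs_exitInd_le_one _ s) (fun s => abs_exitInd_le_one _ s) hB₀ hm₀0 1 (fun _ => (0 : ℝ)) hC ν y'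
  rw [h4.tsum_eq, zero_mul, add_zero, ← mul_assoc (cE * wE d Lc 1)]
  -- re-gauge inside the image, then slip the scalar into the potential
  have hre := tsum_sum_wΦ_mul_axProjAt_eq (Lc ^ (0 + 1)) hr hm'B ν y'
  simp only [hm'] at hre
  rw [← hre]
  exact const_mul_E2image A (wVH d Lc (0 + 1)) (Lc ^ (0 + 1)) (axProjAt (toSite r) Lc m') ν y'

/-! ## §5 The rung `j + 1 → j + 2` and the induction -/

/-- NOT IN PRINT; OUR BOOKKEEPING.  **THE RUNG `j+1 → j+2` OF THE TOWER** (in-block root, `α ≠ β`, all `cE cVH cΛ`, `M ≥ 1`): IF at level `j+1` the `Lc·(Lc·M)`-exit charge function of the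
pure table is `Δ_{j+1}`-exact with a bounded, comb-gauged, `Lc·(Lc·M)`-periodic potential `m`, THEN at level `j+2` the `Lc·M`-exit charge function is `Δ_{j+2}`-exact with such a potential
of period `Lc·M` — PART D (pure → full member) ⨾ (W) ⨾ `ChargeTowerClimb` §7 (`f_i = 𝟙^{exit,Lc·M}`, `c = 0`) ⨾ `ChargeTowerRegauge` §2 (re-gauge inside the image) ⨾ the scalar
`(cE·wE_{j+2})·cH_{j+1}²` slipped into the potential ⨾ the periodicity ledger (one factor of `Lc` spent).  Explicitly `m″ = (cE·wE_{j+2})·cH_{j+1}²·Π^ρ((σ_{j+1}∕wVH_{j+2})·𝒬_{Lc} m)`. -/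
theorem tower_succ (hr : r ∈ box (d + 1) Lc) (cE cVH cΛ : ℝ) {α β : Fin (d + 1)} (j : ℕ) {M : ℕ} (hM : 1 ≤ M)
    {m : Form1 (d + 1) ℝ} {B : ℝ} (hmB : ∀ κ u, |m κ u| ≤ B) (hm0 : ∀ κ u, IsCombBondAt (toSite r) Lc κ u → m κ u = 0)
    (hper : ∀ κ x v, m κ (x + ((Lc * (Lc * M) : ℕ) : ℤ) • v) = m κ x)
    (hT : ∀ (κ : Fin (d + 1)) (u : Site (d + 1)), ∑' xz : Site (d + 1) × Site (d + 1),
        (if xz.1 α % ((Lc * (Lc * M) : ℕ) : ℤ) = ((Lc * (Lc * M) : ℕ) : ℤ) - 1 then (1 : ℝ) else 0)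
          * (if xz.2 β % ((Lc * (Lc * M) : ℕ) : ℤ) = ((Lc * (Lc * M) : ℕ) : ℤ) - 1 then (1 : ℝ) else 0)
          * SpureRecAt d Lc (toSite r) cE cVH cΛ (j + 1) κ u xz.1 xz.2 (Sum.inl α) (Sum.inl β)
        = wVH d Lc (j + 1) * ∑' v, ∑ l : Fin (d + 1), wΦ (N := Lc ^ (j + 1)) κ l (u - v) * m l v) :
    ∃ m'' : Form1 (d + 1) ℝ, (∃ B'' : ℝ, ∀ κ u, |m'' κ u| ≤ B'') ∧ (∀ κ u, IsCombBondAt (toSite r) Lc κ u → m'' κ u = 0) ∧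
      (∀ κ x v, m'' κ (x + ((Lc * M : ℕ) : ℤ) • v) = m'' κ x) ∧
      ∀ (ν : Fin (d + 1)) (y' : Site (d + 1)), ∑' xz : Site (d + 1) × Site (d + 1),
        (if xz.1 α % ((Lc * M : ℕ) : ℤ) = ((Lc * M : ℕ) : ℤ) - 1 then (1 : ℝ) else 0) * (if xz.2 β % ((Lc * M : ℕ) : ℤ) = ((Lc * M : ℕ) : ℤ) - 1 then (1 : ℝ) else 0)
          * SpureRecAt d Lc (toSite r) cE cVH cΛ (j + 2) ν y' xz.1 xz.2 (Sum.inl α) (Sum.inl β)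
        = wVH d Lc (j + 2) * ∑' v, ∑ l : Fin (d + 1), wΦ (N := Lc ^ (j + 2)) ν l (y' - v) * m'' l v := by
  classical
  have hLc : 1 ≤ Lc := one_le_of_neZero Lc
  have hLM : 1 ≤ Lc * M := Nat.one_le_iff_ne_zero.2 (Nat.mul_ne_zero (by omega) (by omega))
  -- the climbed potential, re-gauged (bounded and comb-gauged by `ChargeTowerRegauge` §3)
  obtain ⟨hPiB, hPi0⟩ := axProjAt_climbed_bdd_and_comb_zero hr j hmB
  set m' : Form1 (d + 1) ℝ := fun l v => (stepScale d Lc (j + 1) / wVH d Lc (j + 2)) * contourSum Lc m l v with hm'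
  have hm'B : ∀ l v, |m' l v| ≤ |stepScale d Lc (j + 1) / wVH d Lc (j + 2)| * ((box (d + 1) Lc).card * (Lc * B)) := fun l v =>
    abs_smul_contourSum_le Lc hmB _ l v
  have hm'per : ∀ l x v, m' l (x + ((Lc * M : ℕ) : ℤ) • v) = m' l x := fun l x v => by
    simp only [hm']
    rw [contourSum_add_zsmul_of_periodic_mul (Lc * M) hper l x v]
  set A : ℝ := (cE * wE d Lc (j + 2)) * ((stepScale d Lc (j + 1) * (Lc : ℝ) ^ (d + 1))⁻¹ ^ 2) with hA
  refine ⟨fun l v => A * axProjAt (toSite r) Lc m' l v,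
    ⟨|A| * (|stepScale d Lc (j + 1) / wVH d Lc (j + 2)| * ((box (d + 1) Lc).card * (Lc * B))
        + 2 * ((((d + 1 : ℕ) : ℝ)) * Lc * (|stepScale d Lc (j + 1) / wVH d Lc (j + 2)| * ((box (d + 1) Lc).card * (Lc * B))))),
      fun κ u => by rw [abs_mul]; exact mul_le_mul_of_nonneg_left (hPiB κ u) (abs_nonneg _)⟩,
    fun κ u h => by simp only [hPi0 κ u h, mul_zero],
    fun κ x v => by simp only [axProjAt_add_zsmul_of_periodic_mul M (toSite r) hm'per κ x v], fun ν y' => ?_⟩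
  -- the hypothesis `hC` of `ChargeTowerClimb` §7 on the FULL member: PART D ⨾ (W) ⨾ `hT`
  have hC : ∀ (κ : Fin (d + 1)) (u : Site (d + 1)), ∑' yw : Site (d + 1) × Site (d + 1),
      (if yw.1 α % (Lc : ℤ) = (Lc : ℤ) - 1 then (if blk Lc yw.1 α % ((Lc * M : ℕ) : ℤ) = ((Lc * M : ℕ) : ℤ) - 1 then (1 : ℝ) else 0) else 0)
        * (if yw.2 β % (Lc : ℤ) = (Lc : ℤ) - 1 then (if blk Lc yw.2 β % ((Lc * M : ℕ) : ℤ) = ((Lc * M : ℕ) : ℤ) - 1 then (1 : ℝ) else 0) else 0)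
        * SrecAt d Lc (toSite r) cE cVH cΛ (j + 1) κ u yw.1 yw.2 (Sum.inl α) (Sum.inl β)
      = (wVH d Lc (j + 1) * ∑' v, ∑ l : Fin (d + 1), wΦ (N := Lc ^ (j + 1)) κ l (u - v) * m l v) + (fun _ : Fin (d + 1) => (0 : ℝ)) κ := by
    intro κ u
    have hD := tsum_prod_exitWt_srecAt_eq_spureRecAt hLc hr cE cVH cΛ (j + 1)
      (f₁ := fun s : ℤ => if s % ((Lc * M : ℕ) : ℤ) = ((Lc * M : ℕ) : ℤ) - 1 then (1 : ℝ) else 0)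
      (f₂ := fun s : ℤ => if s % ((Lc * M : ℕ) : ℤ) = ((Lc * M : ℕ) : ℤ) - 1 then (1 : ℝ) else 0)
      (fun s => abs_exitInd_le_one _ s) (fun s => abs_exitInd_le_one _ s) κ u α β
    rw [hD, add_zero, ← hT κ u]
    refine tsum_congr fun yw => ?_
    rw [exitWt_blk_eq hLc hLM yw.1 α, exitWt_blk_eq hLc hLM yw.2 β]
  -- `ChargeTowerClimb` §7 with `c = 0`
  have h7 := hasSum_prod_coordWeighted_SpureRecAt_of_exact_add_const hr cE cVH cΛ j α β
    (fun s : ℤ => if s % ((Lc * M : ℕ) : ℤ) = ((Lc * M : ℕ) : ℤ) - 1 then (1 : ℝ) else 0)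
    (fun s : ℤ => if s % ((Lc * M : ℕ) : ℤ) = ((Lc * M : ℕ) : ℤ) - 1 then (1 : ℝ) else 0)
    (fun s => abs_exitInd_le_one _ s) (fun s => abs_exitInd_le_one _ s) hmB hm0 (fun _ => (0 : ℝ)) hC ν y'
  rw [h7.tsum_eq, zero_mul, add_zero, ← mul_assoc (cE * wE d Lc (j + 2))]
  -- re-gauge inside the image, then slip the scalar into the potential
  have hre := tsum_sum_wΦ_mul_axProjAt_eq (Lc ^ (j + 2)) hr hm'B ν y'
  simp only [hm'] at hre
  rw [← hre]
  exact const_mul_E2image A (wVH d Lc (j + 2)) (Lc ^ (j + 2)) (axProjAt (toSite r) Lc m') ν y'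

/-- NOT IN PRINT; OUR BOOKKEEPING.  **THE Δ-EXACT CHARGE TOWER, EVERY LEVEL, EVERY EXTRA PERIOD** (in-block root, `α ≠ β`, all `cE cVH cΛ`; induction on `j` with `M ↦ Lc·M` in the
hypothesis: base §4, rung §5): for every `j` and every `M ≥ 1` there is a 1-form `m` — BOUNDED, ZERO ON THE COMB BONDS, `(Lc·M)`-PERIODIC — with
`∀ ν y′, Σ'_{(x,z)} 𝟙^{exit,Lc·M}_α(x)·𝟙^{exit,Lc·M}_β(z)·SpureRecAt … (j+1) ν y′ x z (inl α)(inl β) = wVH_{j+1}·Σ'_v Σ_l wΦ_{Lc^{j+1}} ν l (y′ − v)·m l v = (Δ_{j+1} m)(ν,y′)`. -/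
theorem tower (hr : r ∈ box (d + 1) Lc) (cE cVH cΛ : ℝ) {α β : Fin (d + 1)} (hαβ : α ≠ β) (j : ℕ) :
    ∀ {M : ℕ}, 1 ≤ M →
      ∃ m : Form1 (d + 1) ℝ, (∃ B : ℝ, ∀ κ u, |m κ u| ≤ B) ∧ (∀ κ u, IsCombBondAt (toSite r) Lc κ u → m κ u = 0) ∧
        (∀ κ x v, m κ (x + ((Lc * M : ℕ) : ℤ) • v) = m κ x) ∧
        ∀ (ν : Fin (d + 1)) (y' : Site (d + 1)), ∑' xz : Site (d + 1) × Site (d + 1),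
          (if xz.1 α % ((Lc * M : ℕ) : ℤ) = ((Lc * M : ℕ) : ℤ) - 1 then (1 : ℝ) else 0) * (if xz.2 β % ((Lc * M : ℕ) : ℤ) = ((Lc * M : ℕ) : ℤ) - 1 then (1 : ℝ) else 0)
            * SpureRecAt d Lc (toSite r) cE cVH cΛ (j + 1) ν y' xz.1 xz.2 (Sum.inl α) (Sum.inl β)
          = wVH d Lc (j + 1) * ∑' v, ∑ l : Fin (d + 1), wΦ (N := Lc ^ (j + 1)) ν l (y' - v) * m l v := by
  induction j with
  | zero => exact fun hM => tower_zero hr cE cVH cΛ hαβ hM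
  | succ j ih =>
    intro M hM
    have hLM : 1 ≤ Lc * M := Nat.one_le_iff_ne_zero.2 (Nat.mul_ne_zero (NeZero.ne Lc) (by omega))
    obtain ⟨m, ⟨B, hmB⟩, hm0, hper, hT⟩ := ih hLM
    exact tower_succ hr cE cVH cΛ j hM hmB hm0 hper hT

end Summit.QuantumFields.BalabanUV.Beta.GAN24.ChargeTowerInduction

end
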